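import Summits.Ventures.QEC.CircuitDistance.PortK2DataBB144Z
import Summits.Ventures.QEC.CircuitDistance.K2Chunks
import HarnessLib

/-!
# K2(`[[144,12,12]]`) chunk module — COMPUTATIONAL (native_decide; `Lean.ofReduceBool`)

Cell `qec`, CDX, R146/R152 STEP 1 («computational» header; `ofReduceBool` confined to these chunk modules). Checker of record
`K2.K2Data` (qec-cdx-type-1, PortK2Check); data module of record `PortK2DataBB144X/Z` (p669158/9, crit-1 data audit PASS
2026-08-28T21:20Z); chunk glue `K2Chunks` (idea-1 g2). Cube 0, child 16: leaf group 6 of 7.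
Leaf theorems: the K2 DFS accepts below one descendant state of pivot cube 0 (sector Z); sizes are exact DFS visit counts
(eng-1 g2 `k2count.c`), capped so that the gate's native-axiom audit re-verifies every leaf in place. Assemblies re-derive the
child lists in the kernel (`decide`) and end in the literal cube fact `d144Z.cube (Ts144Z.getD 0 []) (0) (lives144Z.getD 0 0) = true`
(the `hcubes` hypothesis of `K2Inst.k2_complete`). Emitted by qec-cdx-eng-1 g2 (`gen2.py`, idea-1's `gen_k2chunks_from_lean.py` lineage).
-/

namespace Summit.Ventures.QEC.CircuitDistance.K2

set_option maxRecDepth 100000 in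
set_option maxHeartbeats 0 in
set_option exponentiation.threshold 1024 in
/-- K2(144) chunk fact `cube144Z0_ch16_14` (459598 DFS visits; see the module docstring). -/
theorem cube144Z0_ch16_14 : app5 (d144Z.dfs (Ts144Z.getD 0 []) 6) (2509928147519837077504, 1672, 1989292945639203107727601900885830025921848376581897349246555927379297879448574865965057, 3, 2348542582773833227887491303843695986745692016340207656508372015861793573216985698632113075591603503069396956) = true := by native_decide

set_option maxRecDepth 100000 in
set_option maxHeartbeats 0 in
set_option exponentiation.threshold 1024 in
/-- K2(144) chunk fact `cube144Z0_ch16_15` (428421 DFS visits; see the module docstring). -/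
theorem cube144Z0_ch16_15 : app5 (d144Z.dfs (Ts144Z.getD 0 []) 6) (148744906087262586880, 3724, 1989292945642765071410195123694269953683346100309805556782657175198871037550380787433473, 3, 2348542582773833227887491303843692368242903350209100669915090494364673158529964897364486842542103255784095708) = true := by native_decide

set_option maxRecDepth 100000 in
set_option maxHeartbeats 0 in
set_option exponentiation.threshold 1024 in
/-- K2(144) chunk fact `cube144Z0_ch16_16` (835493 DFS visits; see the module docstring). -/
theorem cube144Z0_ch16_16 : app5 (d144Z.dfs (Ts144Z.getD 0 []) 6) (446198689457917394944, 4, 5967878836917439705864586977761850081205473809568172609285567722717913964150400506396673, 3, 2348542582773833227883512717952414075105660292223926103194286845158294376790441185549341566566002988779831260) = true := by native_decide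

set_option maxRecDepth 100000 in
set_option maxHeartbeats 0 in
set_option exponentiation.threshold 1024 in
/-- K2(144) chunk fact `cube144Z0_ch16_17` (410329 DFS visits; see the module docstring). -/
theorem cube144Z0_ch16_17 : app5 (d144Z.dfs (Ts144Z.getD 0 []) 6) (1329336808277366800640, 1692, 33817980075865491666565992873983817126831018254219644785951550428734845796852269536247809, 3, 2348542582773833227851684030822187730007715828342529569427857651507264122874251491028179358757200852745715676) = true := by native_decide
end Summit.Ventures.QEC.CircuitDistance.K2
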